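import Summits.QuantumFields.YangMills.Theorems.UnitScaleTiltProp7TransplantGen1F0Rows
import Summits.QuantumFields.YangMills.Theorems.UnitScaleTiltProp7TransplantGen1Cutoff
import Summits.QuantumFields.YangMills.Theorems.UnitScaleTiltProp7TransplantGen1Numbers
import HarnessLib

/-!
# Route `UnitScaleTilt`, crux K1 «MinimiserStabilityRegPr» (stmt-QuantumFields-19200), route-R E′ path (α′), (E1-b) at the CURVED background — (A-cov) gen-1, FILE «GEN-1 PACKAGE» (the glue):
# THE WHOLE gen-1 SIDE OF ONE BOND IN ONE `obtain` — at a pole `b` and cutoff scale `n := L^k`, for a bi-contractive pair `U, Fr` with CONE rows in px22's letters `t₁ z := A₁·(tdist(z,b) + 1)`,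
# `t₂ z := A₀ + A₂·(tdist(z,b) + 2)` and a weight `0 ≤ ω ≤ Ω` on `S′ = {tdist(·,b) ≤ 9L^k + L^k}`, and gen-0's junk field `E₂` with `‖E₂ z‖ ≤ D∕(1∨tdist(z,b))²` on `S = {tdist ≤ 9L^k}`, `0` off `S`
# (✓p681217's (J) conjunct): gen-1 fields `F F′ c₁′ c₂′` and the density `J := R(Fr)⁻¹E₂` with `R(Fr)J = E₂`, the triple-prime identities `Δ_flat F = F′ + c₁′`, `Δ_flat F′ = J − 0 − c₂′`, `F = 0` on the
# centres (so `u₁ := 0`), and the FIVE gen-1 numbers `N2₁ H₁ S₁` (closed form), `N3₁ = N4₁ = 0` of ✓ `htr_body_of_rows` (v1.2) — routeR-w6 ✓p683981 (F₀ rows) ∘ px11 `exists_cutoff_layer` ∘ routeR-w6 `gen1_numbers_closed`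

Cell `ym3-torus`, extra width seat `ym-routeR-w6` (gen 7); split of record ★routeR-w3 g6 00:31:08Z.  THEOREMS ONLY (0 `def`, 0 `sorry`); `--supports stmt-QuantumFields-19200`, count-neutral.
YM₃ on T³ is a ladder rung (R3), not the Clay problem; nothing here claims a stub, the crux, d = 4 or the mass gap.

WHAT IS PROVED (ns `…Theorems.Prop7TransplantGen1Package`).
* `norm_R_le_of_bicontr` (`‖R g X‖ ≤ ‖X‖` for bi-contractive `g`), ★★★ `exists_gen1_package` (see the title; every `L^k`-power explicit, letters `E := D(8+192·9L^k)`, `Φ⁺ := C·E·(3 + 18L^k + L^k)`,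
  `c_d = 10√d + 6` substituted in place as in px11's F2).
HONEST SCOPE.  Plumbing; the `ℓ`-bookkeeping (`N2₁ + W₀(3H₁ + 5A·S₁) ≤ c₁·ℓ·rX`) is the next file «GEN-1 ARITHMETIC»; the member theorem (px22) feeds both packages to the v1.2 assembly.

References: T. Bałaban, CMP 99 (1985) 389–434 [Balaban1985BackgroundPropagators] ((3.8) p.392, (3.35) p.396); CMP 96 (1984) 223–250 [Balaban1984PropagatorsII] ((1.9) p.226); CMP 95 (1984) 17–40
[Balaban1984PropagatorsI] ((1.21) p.21); CMP 99 (1985) 75–102 [Balaban1985RegularSpaces] ((1.36) p.82).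
-/

set_option autoImplicit false

noncomputable section

open scoped BigOperators Matrix.Norms.L2Operator Matrix
open Finset

namespace Summit.QuantumFields.YangMills.Theorems.Prop7TransplantGen1Package

open Literature.MathematicalPhysics.QuantumFieldTheory.Balaban1983to89
open B9Eq39Adjoint (R R_def covD covDstar divB R_R_inv)
open B9TorusCalculus (torusT torusT_apply torusT_symm_apply)
open B15DeterminingSets (embIter)
open LatticeFieldCalculus (laplace)
open B5Eq117TorusCarriers (EK)
open Literature.Probability.LatticeModels (torusGreen)
open Prop7TransplantGen1F0Rows (exists_F0_rows)
open Prop7TransplantGen1Cutoff (exists_cutoff_layer)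
open Prop7TransplantGen1Numbers (gen1_numbers_closed)
open Prop7TransplantGen0Numbers (mem_ball_iff)

variable {P : Params} {N : ℕ}

/-- `‖R g X‖ ≤ ‖X‖` for a bi-contractive unit `g` (matrix algebra). [folklore] -/
theorem norm_R_le_of_bicontr {g : (Matrix (Fin N) (Fin N) ℂ)ˣ}
    (hg : ‖(g : Matrix (Fin N) (Fin N) ℂ)‖ ≤ 1 ∧ ‖((g⁻¹ : (Matrix (Fin N) (Fin N) ℂ)ˣ) : Matrix (Fin N) (Fin N) ℂ)‖ ≤ 1) (X : Matrix (Fin N) (Fin N) ℂ) :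
    ‖R g X‖ ≤ ‖X‖ := by
  rw [R_def]
  have h1 : ‖(g : Matrix (Fin N) (Fin N) ℂ) * X‖ ≤ ‖X‖ :=
    (norm_mul_le _ _).trans (by nlinarith [norm_nonneg X, norm_nonneg (g : Matrix (Fin N) (Fin N) ℂ), hg.1])
  exact (norm_mul_le _ _).trans (by nlinarith [norm_nonneg ((g : Matrix (Fin N) (Fin N) ℂ) * X), norm_nonneg ((g⁻¹ : (Matrix (Fin N) (Fin N) ℂ)ˣ) : Matrix (Fin N) (Fin N) ℂ), hg.2])

/-- ★★★ **THE gen-1 PACKAGE** (see the module docstring). [cite: Balaban1985BackgroundPropagators, (3.8) p.392, (3.35) p.396; Balaban1984PropagatorsII, (1.9) p.226; Balaban1984PropagatorsI, (1.21) p.21;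
Balaban1985RegularSpaces, (1.36) p.82] -/
theorem exists_gen1_package : ∃ C : ℝ, 0 ≤ C ∧ ∀ (P : Params) (_ : P.d = 3) (k : ℕ) (hk : k ≤ P.m + P.K) (_ : 3 ≤ P.L ^ k) (b : Site P 0) {N : ℕ}
    (U : Fin P.d → Site P 0 → (Matrix (Fin N) (Fin N) ℂ)ˣ) (Fr : Site P 0 → (Matrix (Fin N) (Fin N) ℂ)ˣ)
    (_ : ∀ (κ : Fin P.d) (y : Site P 0), ‖(U κ y : Matrix (Fin N) (Fin N) ℂ)‖ ≤ 1 ∧ ‖(((U κ y)⁻¹ : (Matrix (Fin N) (Fin N) ℂ)ˣ) : Matrix (Fin N) (Fin N) ℂ)‖ ≤ 1)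
    (_ : ∀ z : Site P 0, ‖(Fr z : Matrix (Fin N) (Fin N) ℂ)‖ ≤ 1 ∧ ‖(((Fr z)⁻¹ : (Matrix (Fin N) (Fin N) ℂ)ˣ) : Matrix (Fin N) (Fin N) ℂ)‖ ≤ 1)
    (A₀ A₁ A₂ : ℝ) (_ : 0 ≤ A₀) (_ : 0 ≤ A₁) (_ : 0 ≤ A₂)
    (_ : ∀ z ∈ (univ.filter fun z : Site P 0 => Site.tdist z b ≤ 9 * P.L ^ k + P.L ^ k), ∀ μ,
      ‖(((Fr z)⁻¹ * U μ z * Fr (torusT P 0 μ z) : (Matrix (Fin N) (Fin N) ℂ)ˣ) : Matrix (Fin N) (Fin N) ℂ) - 1‖ ≤ A₁ * ((Site.tdist z b : ℝ) + 1))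
    (_ : ∀ z ∈ (univ.filter fun z : Site P 0 => Site.tdist z b ≤ 9 * P.L ^ k + P.L ^ k), ∀ μ,
      ‖(((Fr ((torusT P 0 μ).symm z))⁻¹ * U μ ((torusT P 0 μ).symm z) * Fr (torusT P 0 μ ((torusT P 0 μ).symm z)) : (Matrix (Fin N) (Fin N) ℂ)ˣ) :
        Matrix (Fin N) (Fin N) ℂ) - 1‖ ≤ A₁ * ((Site.tdist z b : ℝ) + 1))
    (_ : ∀ z ∈ (univ.filter fun z : Site P 0 => Site.tdist z b ≤ 9 * P.L ^ k + P.L ^ k), ∀ μ,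
      ‖(((Fr z)⁻¹ * U μ z * Fr (torusT P 0 μ z) : (Matrix (Fin N) (Fin N) ℂ)ˣ) : Matrix (Fin N) (Fin N) ℂ)
        - (((Fr ((torusT P 0 μ).symm z))⁻¹ * U μ ((torusT P 0 μ).symm z) * Fr (torusT P 0 μ ((torusT P 0 μ).symm z)) : (Matrix (Fin N) (Fin N) ℂ)ˣ) :
          Matrix (Fin N) (Fin N) ℂ)‖ ≤ A₀ + A₂ * ((Site.tdist z b : ℝ) + 2))
    (ω : Site P 0 → ℝ) (Ω : ℝ) (_ : 0 ≤ Ω) (_ : ∀ z ∈ (univ.filter fun z : Site P 0 => Site.tdist z b ≤ 9 * P.L ^ k + P.L ^ k), 0 ≤ ω z ∧ ω z ≤ Ω)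
    (E₂ : Site P 0 → Matrix (Fin N) (Fin N) ℂ) (D : ℝ) (_ : 0 ≤ D)
    (_ : ∀ z ∈ (univ.filter fun z : Site P 0 => Site.tdist z b ≤ 9 * P.L ^ k), ‖E₂ z‖ ≤ D / (max 1 ((Site.tdist z b : ℕ) : ℝ)) ^ 2)
    (_ : ∀ z ∉ (univ.filter fun z : Site P 0 => Site.tdist z b ≤ 9 * P.L ^ k), E₂ z = 0),
    ∃ F F' c₁' c₂' J : Site P 0 → Matrix (Fin N) (Fin N) ℂ,
      -- the density and the identities at `m := 0`
      (∀ z, R (Fr z) (J z) = E₂ z) ∧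
      (∀ z, (∑ μ : Fin P.d, ((F z - F (torusT P 0 μ z)) + (F z - F ((torusT P 0 μ).symm z)))) = F' z + c₁' z) ∧
      (∀ z, (∑ ν : Fin P.d, ((F' z - F' (torusT P 0 ν z)) + (F' z - F' ((torusT P 0 ν).symm z)))) = J z - 0 - c₂' z) ∧
      -- the near datum `u₁ := 0`
      (∀ y ∈ Set.range (embIter k), (fun _ : Site P 0 => (0 : Matrix (Fin N) (Fin N) ℂ)) y = R (Fr y) (F y)) ∧
      -- (N2₁)
      (∑ z, Real.sqrt (∑ j : Fin N, ∑ k' : Fin N, ‖(divB (torusT P 0) U (fun μ => covD (torusT P 0) U μ (fun y => R (Fr y) (F y))) z) j k'‖ ^ 2)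
        ≤ Real.sqrt N * (Real.sqrt (((univ.filter fun z : Site P 0 => Site.tdist z b ≤ 9 * P.L ^ k).card : ℕ) : ℝ) * Real.sqrt ((C * D) ^ 2 * (3 * ((45 * P.L ^ k : ℕ) : ℝ)) * (8 + 128 * ((9 * P.L ^ k : ℕ) : ℝ) ^ 2)) + ((((univ.filter fun z : Site P 0 => Site.tdist z b ≤ 9 * P.L ^ k + P.L ^ k).card : ℕ) : ℝ) * ((P.d * (2 * (3 / (2 * ((P.L ^ k : ℕ) : ℝ))) * (C * (D * (8 + 192 * ((9 * P.L ^ k : ℕ) : ℝ)))) + 9 / ((P.L ^ k : ℕ) : ℝ) ^ 2 * (C * (D * (8 + 192 * ((9 * P.L ^ k : ℕ) : ℝ))) * (3 + 18 * ((P.L ^ k : ℕ) : ℝ) + (P.L : ℝ) ^ k))) + (C * (D * (8 + 192 * ((9 * P.L ^ k : ℕ) : ℝ))) * (3 + 18 * ((P.L ^ k : ℕ) : ℝ) + (P.L : ℝ) ^ k)) * (9 * P.d * (10 * Real.sqrt P.d + 6) ^ 2 / ((P.L : ℝ) ^ k) ^ 2))) + (C * (D * (8 + 192 * ((9 * P.L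 ^ k : ℕ) : ℝ)))) * (8 + 128 * ((9 * P.L ^ k + P.L ^ k : ℕ) : ℝ) ^ 2)))
        + Real.sqrt N * ((((univ.filter fun z : Site P 0 => Site.tdist z b ≤ 9 * P.L ^ k + P.L ^ k).card : ℕ) : ℝ) * (P.d * ((2 * (A₀ + A₂ * (((9 * P.L ^ k + P.L ^ k : ℕ) : ℝ) + 2)) + 4 * (A₁ * (((9 * P.L ^ k + P.L ^ k : ℕ) : ℝ) + 1)) ^ 2) * (2 * (C * (D * (8 + 192 * ((9 * P.L ^ k : ℕ) : ℝ))) * (3 + 18 * ((P.L ^ k : ℕ) : ℝ) + (P.L : ℝ) ^ k))) + 4 * (A₁ * (((9 * P.L ^ k + P.L ^ k : ℕ) : ℝ) + 1)) * (C * (D * (8 + 192 * ((9 * P.L ^ k : ℕ) : ℝ))) + 3 / (2 * ((P.L ^ k : ℕ) : ℝ)) * (C * (D * (8 + 192 * ((9 * P.L ^ k : ℕ) : ℝ))) * (3 + 18 * ((P.L ^ k : ℕ) : ℝ) + (P.L : ℝ) ^ k)) + (C * (D * (8 + 192 * ((9 * P.L ^ k : ℕ) : ℝ))) * (3 + 18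 * ((P.L ^ k : ℕ) : ℝ) + (P.L : ℝ) ^ k)) * (3 * (10 * Real.sqrt P.d + 6) / (2 * ((P.L : ℝ) ^ k)))))))) ∧
      -- (N3₁), (N4₁)
      (∑ z, Real.sqrt (∑ j : Fin N, ∑ k' : Fin N, ‖(divB (torusT P 0) U (fun μ => covD (torusT P 0) U μ (fun _ : Site P 0 => (0 : Matrix (Fin N) (Fin N) ℂ))) z) j k'‖ ^ 2) ≤ 0 ∧
        Real.sqrt (∑ z, ω z ^ 2 * ∑ j : Fin N, ∑ k' : Fin N,
          ‖(divB (torusT P 0) U (fun μ => covD (torusT P 0) U μ (fun _ : Site P 0 => (0 : Matrix (Fin N) (Fin N) ℂ))) z) j k'‖ ^ 2) ≤ 0) ∧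
      -- (H₁) for the defined `K₁`
      (∀ K₁ : Site P 0 → Matrix (Fin N) (Fin N) ℂ,
        (∀ z, K₁ z = divB (torusT P 0) U (fun μ => covD (torusT P 0) U μ (fun y => R (Fr y) (F y))) z
          - R (Fr z) (∑ μ : Fin P.d, ((F z - F (torusT P 0 μ z)) + (F z - F ((torusT P 0 μ).symm z))))) →
        Real.sqrt (∑ z, ω z ^ 2 * ∑ j : Fin N, ∑ k' : Fin N, ‖(K₁ z + R (Fr z) (c₁' z)) j k'‖ ^ 2)
          ≤ Ω * (Real.sqrt N * (Real.sqrt (((univ.filter fun z : Site P 0 => Site.tdist z b ≤ 9 * P.L ^ k + P.L ^ k).card : ℕ) : ℝ) * (P.d * ((2 * (A₀ + A₂ * (((9 * P.L ^ k + P.L ^ k : ℕ) : ℝ) + 2)) + 4 * (A₁ * (((9 * P.L ^ k + P.L ^ k : ℕ) : ℝ) + 1)) ^ 2) * (2 * (C * (D * (8 + 192 * ((9 * P.L ^ k : ℕ) : ℝ))) * (3 + 18 * ((P.L ^ k : ℕ) : ℝ) + (P.L : ℝ) ^ k))) + 4 * (A₁ * (((9 * P.L ^ k + P.L ^ k : ℕ)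 : ℝ) + 1)) * (C * (D * (8 + 192 * ((9 * P.L ^ k : ℕ) : ℝ))) + 3 / (2 * ((P.L ^ k : ℕ) : ℝ)) * (C * (D * (8 + 192 * ((9 * P.L ^ k : ℕ) : ℝ))) * (3 + 18 * ((P.L ^ k : ℕ) : ℝ) + (P.L : ℝ) ^ k)) + (C * (D * (8 + 192 * ((9 * P.L ^ k : ℕ) : ℝ))) * (3 + 18 * ((P.L ^ k : ℕ) : ℝ) + (P.L : ℝ) ^ k)) * (3 * (10 * Real.sqrt P.d + 6) / (2 * ((P.L : ℝ) ^ k))))))))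
          + Ω * Real.sqrt (N * (2 * ((((univ.filter fun z : Site P 0 => Site.tdist z b ≤ 9 * P.L ^ k + P.L ^ k).card : ℕ) : ℝ) * ((P.d * (2 * (3 / (2 * ((P.L ^ k : ℕ) : ℝ))) * (C * (D * (8 + 192 * ((9 * P.L ^ k : ℕ) : ℝ)))) + 9 / ((P.L ^ k : ℕ) : ℝ) ^ 2 * (C * (D * (8 + 192 * ((9 * P.L ^ k : ℕ) : ℝ))) * (3 + 18 * ((P.L ^ k : ℕ) : ℝ) + (P.L : ℝ) ^ k))) + (C * (D * (8 + 192 * ((9 * P.L ^ k : ℕ) : ℝ))) * (3 + 18 * ((P.L ^ k : ℕ) : ℝ) + (P.L : ℝ) ^ k)) * (9 * P.d * (10 * Real.sqrt P.d + 6) ^ 2 / ((P.L : ℝ) ^ k) ^ 2))) ^ 2) + 2 * ((C * (D * (8 + 192 * ((9 * P.L ^ k : ℕ) : ℝ)))) ^ 2 * (8 + 192 * ((9 * P.L ^ k + P.L ^ k : ℕ) : ℝ)))))) ∧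
      -- (S₁) for the defined `K₂`
      (∀ K₂ : Site P 0 → Matrix (Fin N) (Fin N) ℂ,
        (∀ z, K₂ z = divB (torusT P 0) U (fun μ => covD (torusT P 0) U μ (fun y => R (Fr y) (F' y))) z
          - R (Fr z) (∑ ν : Fin P.d, ((F' z - F' (torusT P 0 ν z)) + (F' z - F' ((torusT P 0 ν).symm z))))) →
        Real.sqrt (∑ z, ω z ^ 2 * ∑ j : Fin N, ∑ k' : Fin N, ‖(K₂ z - R (Fr z) (c₂' z)) j k'‖ ^ 2)
          ≤ Ω * (Real.sqrt N * Real.sqrt (2 * ((P.d * ((2 * (A₀ + A₂ * (((9 * P.L ^ k + P.L ^ k : ℕ) : ℝ) + 2)) + 4 * (A₁ * (((9 * P.L ^ k + P.L ^ k : ℕ) : ℝ) + 1)) ^ 2) * (C * D) + 4 * (A₁ * (((9 * P.L ^ k + P.L ^ k : ℕ) : ℝ) + 1)) * (3 / (2 * ((P.L ^ k : ℕ) : ℝ)) * (C * D)))) ^ 2 * (3 * ((45 * P.L ^ k : ℕ) : ℝ)) * (8 + 128 * ((9 * P.L ^ k : ℕ) : ℝ) ^ 2))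
            + 2 * ((P.d * (4 * (A₁ * (((9 * P.L ^ k + P.L ^ k : ℕ) : ℝ) + 1)) * (C * D))) ^ 2 * (8 + 192 * ((9 * P.L ^ k : ℕ) : ℝ)))))
          + Ω * Real.sqrt (N * (4 * ((((univ.filter fun z : Site P 0 => Site.tdist z b ≤ 9 * P.L ^ k).card : ℕ) : ℝ) * (D / ((P.L ^ k : ℕ) : ℝ) ^ 2 + (((((P.L ^ k * P.sitesPerDir k : ℕ) : ℝ)) ^ P.d)⁻¹ * (D * (8 + 192 * ((9 * P.L ^ k : ℕ) : ℝ))))) ^ 2) + 4 * ((P.d * (2 * (3 / (2 * ((P.L ^ k : ℕ) : ℝ)))) * (C * D)) ^ 2 * (8 + 192 * ((9 * P.L ^ k : ℕ) : ℝ))) + 2 * ((P.d * (9 / ((P.L ^ k : ℕ) : ℝ) ^ 2) * (C * D)) ^ 2 * (2 * (3 * ((45 * P.L ^ k : ℕ) : ℝ))) * (8 + 128 * ((9 * P.L ^ k : ℕ) : ℝ) ^ 2))))) := by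
  obtain ⟨C, hC, HB⟩ := exists_F0_rows
  refine ⟨C, hC, ?_⟩
  intro P hd k hk h3 b N U Fr hU hFr A₀ A₁ A₂ hA₀ hA₁ hA₂ h1 h1' h2 ω Ω hΩ hω E₂ D hD hE₂ hE₂0
  classical
  have hn3 : 3 ≤ P.L ^ k := h3
  have hn1 : 1 ≤ P.L ^ k := le_trans (by norm_num) hn3
  set S : Finset (Site P 0) := univ.filter fun z : Site P 0 => Site.tdist z b ≤ 9 * P.L ^ k with hSdef
  set S' : Finset (Site P 0) := univ.filter fun z : Site P 0 => Site.tdist z b ≤ 9 * P.L ^ k + P.L ^ k with hS'def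
  -- the density `J := R(Fr)⁻¹ E₂`
  set J : Site P 0 → Matrix (Fin N) (Fin N) ℂ := fun z => R (Fr z)⁻¹ (E₂ z) with hJdef
  have hRJ : ∀ z, R (Fr z) (J z) = E₂ z := fun z => by simp only [hJdef, R_R_inv]
  have hFrinv : ∀ z : Site P 0, ‖(((Fr z)⁻¹ : (Matrix (Fin N) (Fin N) ℂ)ˣ) : Matrix (Fin N) (Fin N) ℂ)‖ ≤ 1
      ∧ ‖((((Fr z)⁻¹)⁻¹ : (Matrix (Fin N) (Fin N) ℂ)ˣ) : Matrix (Fin N) (Fin N) ℂ)‖ ≤ 1 := fun z => by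
    rw [inv_inv]; exact ⟨(hFr z).2, (hFr z).1⟩
  have hJ : ∀ y, ‖J y‖ ≤ D / (max 1 ((Site.tdist y b : ℕ) : ℝ)) ^ 2 := by
    intro y
    by_cases hy : y ∈ S
    · exact (norm_R_le_of_bicontr (hFrinv y) (E₂ y)).trans (hE₂ y hy)
    · simp only [hJdef]; rw [hE₂0 y hy, R_def, mul_zero, zero_mul, norm_zero]; positivity
  have hJ0 : ∀ y, 9 * P.L ^ k < Site.tdist y b → J y = 0 := by
    intro y hy
    have hy' : y ∉ S := by rw [hSdef, mem_ball_iff]; omega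
    simp only [hJdef]; rw [hE₂0 y hy', R_def, mul_zero, zero_mul]
  -- FILE B at `c := b`, `n := L^k`
  obtain ⟨G, -, -, hSJ, hF00, hF01, hsplit, hP1Δ, hP10, hP11, hM10⟩ :=
    HB P hd k hk b b (P.L ^ k) hn1 (by rw [B3Taylor310LocalRemainder.tdist_self]; exact Nat.zero_le _) J D hD hJ hJ0
  -- F2 (px11): the cutoff layer
  have hζ : ∀ _z : Site P 0, ‖(((((P.L ^ k * P.sitesPerDir k : ℕ) : ℝ)) ^ P.d)⁻¹) • ∑ y, J y‖ ≤ ((((P.L ^ k * P.sitesPerDir k : ℕ) : ℝ)) ^ P.d)⁻¹ * (D * (8 + 192 * ((9 * P.L ^ k : ℕ) : ℝ))) := by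
    intro z
    rw [norm_smul, Real.norm_eq_abs, abs_of_nonneg (by positivity)]
    exact mul_le_mul_of_nonneg_left ((norm_sum_le _ _).trans hSJ) (by positivity)
  obtain ⟨F, F', c₁', c₂', hi1, hi2, hSF, hSF', hSc₁, hSc₂, hFC, hΦ₀, hΦ₁, hΓ₁, -, hp₀, hp₁, hp₂⟩ :=
    exists_cutoff_layer hd hk h3 b (P.L ^ k) hn3 (fun z => ∑ y, G y z • J y)
      (fun w => ∑ y, ((1 / 2 : ℝ) * torusGreen (L := P.L ^ k * P.sitesPerDir k) (EK hk y - EK hk w)) • J y)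
      (fun z => ((1 / 2 : ℝ) * torusGreen (L := P.L ^ k * P.sitesPerDir k) (EK hk z - EK hk b)) • ∑ y, J y)
      J (fun _ => ((((P.L ^ k * P.sitesPerDir k : ℕ) : ℝ)) ^ P.d)⁻¹ • ∑ y, J y)
      hsplit hP1Δ hC hD hJ hJ0 hF00 hF01 hP10 hP11 hM10 hζ
  -- FILE C: the numbers
  have hS : ∀ z ∈ S, Site.tdist z b ≤ 9 * P.L ^ k := fun z hz => by rw [hSdef, mem_ball_iff] at hz; exact hz
  have hS' : ∀ z ∈ S', Site.tdist z b ≤ 9 * P.L ^ k + P.L ^ k := fun z hz => by rw [hS'def, mem_ball_iff] at hz; exact hz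
  have hSS' : S ⊆ S' := fun z hz => by rw [hSdef, mem_ball_iff] at hz; rw [hS'def, mem_ball_iff]; omega
  refine ⟨F, F', c₁', c₂', J, hRJ, hi1, hi2, fun y hy => ?_, ?_⟩
  · obtain ⟨y', rfl⟩ := hy
    show (0 : Matrix (Fin N) (Fin N) ℂ) = R (Fr (embIter k y')) (F (embIter k y'))
    rw [hFC y', R_def, mul_zero, zero_mul]
  have key := fun (K₁ K₂ : Site P 0 → Matrix (Fin N) (Fin N) ℂ)
      (hK₁ : ∀ z, K₁ z = divB (torusT P 0) U (fun μ => covD (torusT P 0) U μ (fun y => R (Fr y) (F y))) z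
          - R (Fr z) (∑ μ : Fin P.d, ((F z - F (torusT P 0 μ z)) + (F z - F ((torusT P 0 μ).symm z)))))
      (hK₂ : ∀ z, K₂ z = divB (torusT P 0) U (fun μ => covD (torusT P 0) U μ (fun y => R (Fr y) (F' y))) z
          - R (Fr z) (∑ ν : Fin P.d, ((F' z - F' (torusT P 0 ν z)) + (F' z - F' ((torusT P 0 ν).symm z))))) =>
    gen1_numbers_closed hd U Fr hU hFr b S S' (9 * P.L ^ k) (9 * P.L ^ k + P.L ^ k) hS hS' hSS' hA₀ hA₁ hA₂ h1 h1' h2 ω hΩ hω F F' c₁' c₂' K₁ K₂ hSF hSF' hSc₁ hSc₂ hi1 hK₁ hK₂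
      (Φ₀ := (2 * (C * (D * (8 + 192 * ((9 * P.L ^ k : ℕ) : ℝ))) * (3 + 18 * ((P.L ^ k : ℕ) : ℝ) + (P.L : ℝ) ^ k)))) (Φ₁ := (C * (D * (8 + 192 * ((9 * P.L ^ k : ℕ) : ℝ))) + 3 / (2 * ((P.L ^ k : ℕ) : ℝ)) * (C * (D * (8 + 192 * ((9 * P.L ^ k : ℕ) : ℝ))) * (3 + 18 * ((P.L ^ k : ℕ) : ℝ) + (P.L : ℝ) ^ k)) + (C * (D * (8 + 192 * ((9 * P.L ^ k : ℕ) : ℝ))) * (3 + 18 * ((P.L ^ k : ℕ) : ℝ) + (P.L : ℝ) ^ k)) * (3 * (10 * Real.sqrt P.d + 6) / (2 * ((P.L : ℝ) ^ k))))) (Γ₁ := ((P.d * (2 * (3 / (2 * ((P.L ^ k : ℕ) : ℝ))) * (C * (D * (8 + 192 * ((9 * P.L ^ k : ℕ) : ℝ)))) + 9 / ((P.L ^ k : ℕ) : ℝ) ^ 2 * (C * (D * (8 + 192 * ((9 * P.L ^ k : ℕ) : ℝ))) * (3 + 18 * ((P.L ^ k : ℕ) : ℝ) + (P.L : ℝ)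 ^ k))) + (C * (D * (8 + 192 * ((9 * P.L ^ k : ℕ) : ℝ))) * (3 + 18 * ((P.L ^ k : ℕ) : ℝ) + (P.L : ℝ) ^ k)) * (9 * P.d * (10 * Real.sqrt P.d + 6) ^ 2 / ((P.L : ℝ) ^ k) ^ 2)))) (γ₁ := (C * (D * (8 + 192 * ((9 * P.L ^ k : ℕ) : ℝ))))) (a₀ := (C * D)) (R₀ := (3 * ((45 * P.L ^ k : ℕ) : ℝ))) (a₁ := (C * D)) (a₁' := (3 / (2 * ((P.L ^ k : ℕ) : ℝ)) * (C * D)))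
      (a₂ := (P.d * (2 * (3 / (2 * ((P.L ^ k : ℕ) : ℝ)))) * (C * D))) (a₃ := (D / ((P.L ^ k : ℕ) : ℝ) ^ 2 + (((((P.L ^ k * P.sitesPerDir k : ℕ) : ℝ)) ^ P.d)⁻¹ * (D * (8 + 192 * ((9 * P.L ^ k : ℕ) : ℝ)))))) (a₄ := (P.d * (9 / ((P.L ^ k : ℕ) : ℝ) ^ 2) * (C * D))) (R₄ := (2 * (3 * ((45 * P.L ^ k : ℕ) : ℝ))))
      (by positivity) (by positivity) (by positivity) hΦ₀ hΦ₁
      (fun z hz => (hΓ₁ z hz).trans (le_of_eq (by ring)))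
      (fun z hz => (hp₀ z hz).trans (le_of_eq (by ring)))
      (fun z hz μ => ⟨((hp₁ z hz μ).1).trans (le_of_eq (by ring)), ((hp₁ z hz μ).2).trans (le_of_eq (by ring))⟩)
      (fun z hz => (hp₂ z hz).trans (le_of_eq (by ring)))
  have key₀ := key _ _ (fun z => rfl) (fun z => rfl)
  exact ⟨key₀.1, key₀.2.2.2, fun K₁ hK₁ => (key K₁ _ hK₁ (fun z => rfl)).2.1, fun K₂ hK₂ => (key _ K₂ (fun z => rfl) hK₂).2.2.1⟩

end Summit.QuantumFields.YangMills.Theorems.Prop7TransplantGen1Package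

end
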